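import Literature.NumberTheory.Rogawski1990.XiPinSphericalCofinite                       -- ★ letter #79 (XP) `XiPinSphericalCofinite L` (the TARGET of this pay-down)
import Summits.HodgeConjecture.HodgeConjecture.Theorems.F0P3XiLocalFamilyOfRecordUnram    -- ★ (p01): `eventually_torusLocalComponent_eq_one`, `semilocalComponent_eq_one_of_forall_isUnramifiedAt` (Tate 3.2.1)
import Summits.HodgeConjecture.HodgeConjecture.Theorems.F0P3XiUnramNonsplitInstance       -- ★ (B-p08): `exists_spherical_constituent` — THE spherical admissible constituent of `i_G(χ_ξ,v)`
import Literature.NumberTheory.Rogawski1990.SquareIntegrableNotSphericalCofinite             -- ★ p825942 (typ3 (g8)): the (SqNS) letter `SquareIntegrableNotSphericalCofinite L` (= the `hSq` binder below, VERBATIM) — ED. 2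
import HarnessLib

/-!
# Crux `H413` — PAY-DOWN of letter #79 «XP» `Rogawski1990.XiPinSphericalCofinite` onto ONE classical local fact:
# «a square-integrable (mod centre) class is not `K_v`-spherical» at almost every place

F0∕P3 «U3-mult», cell `hodgecm-mathlib`, crux item `stmt-HodgeConjecture-24833`; F0P3-p03 (g7), director s561 (3) ∕ F0P3-plan (g5) 13:36:35Z (O2).
PROOF lane (theorems only; no `def`, no instance, no notation, no `sorry`; `--supports stmt-HodgeConjecture-24833 --as helper`).
ED. 2 (append-only): + the named junction `xiPinSphericalCofinite_of_squareIntegrableNotSphericalCofinite` from the ★ (SqNS) letter p825942 (RULING (V49) ED. 5 re-point).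

THE POINT.  The (O2) design split XP into four stubs (`stub_xiChars_unram_ae`, `stub_unramPS_sphericalLine`, `stub_sqInt_notSpherical`,
`stub_keysCase2_twoConstituents`).  THREE of them are ALREADY ★ in the tree:
* «the characters `μ_v, η_v, ψ_v` are unramified for all but finitely many (non-split) `v`» = ★ `HeckeCharacter.isUnramifiedAt_cofinite_holds` +
  ★ `F0P3XiLocalFamilyOfRecord.semilocalComponent_eq_one_of_forall_isUnramifiedAt` (B1) + ★ `F0P3XiLocalFamilyOfRecord.eventually_torusLocalComponent_eq_one` (B2)
  [TateThesis1967 Lemma 3.2.1];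
* «the unramified principal series `i_G(χ_ξ,v)` has a `K_v`-spherical LINE and a `K_v`-SPHERICAL ADMISSIBLE CONSTITUENT» = ★ `isSpherical_cmPrincipalSeries_cmXiTorusChar`
  [Rogawski1990 §4.5 p. 45] + ★ `F0P3XiUnramNonsplitInstance.exists_spherical_constituent` (the constituent through the Hecke eigenline, [Bump1997 Prop. 4.2.3]);
* «the constituents of `i_G(χ_ξ,v)` at the case-(2) point are exactly `{πn, πs}`» IS the hypothesis ★ `KeysCaseTwoLabels` of the letter itself.
Hence XP FOLLOWS from the single residual local fact
  **(SqNS) for all but finitely many `v`: every square-integrable-mod-centre class of `U(Φ₃)(L⁺_v)` has NO `K_v = U(Φ₃)(𝒪_v)`-spherical line**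
[Macdonald1971 Ch. V (the spherical Plancherel measure of a `p`-adic group is absolutely continuous on the unitary unramified characters — no square-integrable
class is spherical for hyperspecial `K`); Casselman1980 §4 (exponents of the spherical constituent vs. the square-integrability criterion); for `U(3)` in Keys'
case (2) this is Rogawski1990 §12.2 p. 174 l. 1 «`π²(ξ)` is square-integrable … `πⁿ(ξ)` is unramified if `ξ` is»]: the spherical constituent `c` of
`i_G(χ_ξ,v)` is `πn` or `πs` by the labels; it is not `πs` by (SqNS); so `πn = c` is spherical.
This file proves exactly that implication, with (SqNS) as an explicit HYPOTHESIS in cofinite form (no new `def`: the desk may name (SqNS) as a Literature letter —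
H1, every token is Literature-level: `Gqs`, `IrrClass.IsSquareIntegrable`, `IrrClass.IsSpherical`, `cmLocalIntegralLevel`, `qsForm` — and the ED. of record then
reads `XiPinSphericalCofinite L` as a THEOREM modulo (SqNS)).  BOOKS: #79 (k = 1, bespoke composite) → (SqNS) (k = 1, classical local fact) — 0 net, +1 canonicity;
the (O2) Lines file needs no other stub.
HONEST LABEL: HC_CM is proved only modulo the printed citations until rung 0 closes.
-/

set_option autoImplicit false
set_option linter.dupNamespace false

noncomputable section

open NumberField IsDedekindDomain MeasureTheory Filter

namespace Summit.HodgeConjecture.HodgeConjecture.Cruxes.H413.F0P3XiPinSphericalOfSqIntNotSpherical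

open Literature.NumberTheory Literature.NumberTheory.Automorphic Literature.NumberTheory.Automorphic.UnitaryGroup
open Literature.NumberTheory.Rogawski1990 Literature.NumberTheory.GaloisRepresentations
open Summit.HodgeConjecture.HodgeConjecture.Cruxes.H413.F0P3XiLocalFamilyOfRecord (eventually_torusLocalComponent_eq_one semilocalComponent_eq_one_of_forall_isUnramifiedAt)

variable (L : Type) [Field L] [NumberField L] [IsCMField L]

/-- **XP from (SqNS)**: if, for all but finitely many finite places `v` of `L⁺`, no square-integrable-mod-centre class of `U(Φ₃)(L⁺_v)` is
`U(Φ₃)(𝒪_v)`-spherical (hypothesis `hSq`, the classical local fact [Macdonald1971 Ch. V; Casselman1980 §4]), then letter #79 ★ `XiPinSphericalCofinite L`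
HOLDS: at every such `v` that is moreover non-split with `μ_v, η_v, ψ_v` unramified (cofinitely many, ★ Tate 3.2.1 bridges), the `K_v`-spherical admissible
constituent of `i_G(χ_ξ,v)` (★ `exists_spherical_constituent`) is one of the two Keys labels, and not the square-integrable one.
[cite: Rogawski1990, §12.2 (2) pp. 173–174; Thm. 13.3.6 (b) p. 202] [cite: Macdonald1971, Ch. V] [cite: TateThesis1967, Lemma 3.2.1] -/
theorem xiPinSphericalCofinite_of_eventually_not_isSpherical_of_isSquareIntegrable
    (hSq : ∀ᶠ v : HeightOneSpectrum (𝓞 ↥(maximalRealSubfield L)) in cofinite,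
      ∀ [MeasurableSpace (Gqs L v ⧸ Subgroup.center (Gqs L v))] [BorelSpace (Gqs L v ⧸ Subgroup.center (Gqs L v))]
        (μZ : Measure (Gqs L v ⧸ Subgroup.center (Gqs L v))) [μZ.IsHaarMeasure] (c : IrrClass (Gqs L v)),
        c.IsSquareIntegrable μZ → ¬ c.IsSpherical (cmLocalIntegralLevel L 3 (qsForm L) v)) :
    XiPinSphericalCofinite L := by
  intro μω _hμu ξ
  filter_upwards [hSq, eventually_forall_placesOver (F := ↥(maximalRealSubfield L)) L (HeckeCharacter.isUnramifiedAt_cofinite_holds μω),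
    eventually_torusLocalComponent_eq_one L ξ.η, eventually_torusLocalComponent_eq_one L ξ.ψ] with v hv hμ hη hψ
  intro hns _hquad _ _ μZ _ πs πn hK hs _hn
  -- THE spherical admissible constituent of `i_G(χ_ξ,v)` (unramified data at `v`: Tate 3.2.1 bridges ★ (B1), (B2))
  obtain ⟨r, hrc, -, hr1, -⟩ := F0P3XiUnramNonsplitInstance.exists_spherical_constituent L v (μω.semilocalComponent L v)
    (torusLocalComponent L (IsCMField.complexConj L) v ξ.η) (torusLocalComponent L (IsCMField.complexConj L) v ξ.ψ)
    (semilocalComponent_eq_one_of_forall_isUnramifiedAt L v μω hμ) (fun t _ => hη hns t) (fun t _ => hψ hns t)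
  have hsph : (IrrClass.mk r).IsSpherical (cmLocalIntegralLevel L 3 (qsForm L) v) := (IrrClass.isSpherical_mk r _).2 hr1
  -- it is `πn` or `πs` (Keys' labels), and `πs` is square-integrable hence not spherical (SqNS)
  rcases (hK.2 (IrrClass.mk r)).1 hrc with h | h
  · exact h ▸ hsph
  · exact absurd (h ▸ hsph) (hv μZ πs hs)

/-! ## ED. 2 — the named junction for the ED. 5 re-point of `stub_79` (RULING (V49)): letter (SqNS) ★ p825942 ⇒ letter #79 XP -/

/-- **XP from the (SqNS) LETTER BY NAME**: ★ `Rogawski1990.SquareIntegrableNotSphericalCofinite L` (typ3 (g8) p825942; its body is the hypothesis `hSq` above token for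
token) implies letter #79 ★ `Rogawski1990.XiPinSphericalCofinite L`.  The closer's ED. 5 junction reads
`theorem stub_79 … := fun L _ _ _ => xiPinSphericalCofinite_of_squareIntegrableNotSphericalCofinite L (stub_SqNS L)`.
[cite: Rogawski1990, §12.2 (2) pp. 173–174; Thm. 13.3.6 (b) p. 202] [cite: Macdonald1971, Ch. V] [cite: Casselman1980, §4] -/
theorem xiPinSphericalCofinite_of_squareIntegrableNotSphericalCofinite (h : SquareIntegrableNotSphericalCofinite L) : XiPinSphericalCofinite L :=
  xiPinSphericalCofinite_of_eventually_not_isSpherical_of_isSquareIntegrable L h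

end Summit.HodgeConjecture.HodgeConjecture.Cruxes.H413.F0P3XiPinSphericalOfSqIntNotSpherical

end
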